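import Summits.HubbardSuperconductivity.HubbardSuperconductivity.Theorems.TwistGapTgCruxGlue
import Literature.MathematicalPhysics.QuantumLattice.PairFieldMomentum

/-!
# Route `TwistGap`, crux `TgLowEnergyCondensation` (stmt-HubbardSuperconductivity-1510):
# the condensation half follows from route DeformationLadder's crux, and from `S⁺`

The window sum `Σ_{k ∈ W_K} P_k(φ)` of `TgLowEnergyCondensation` (`P_k(φ) = L⁻⁴ Re⟨φ, Δ_d(k)ᴴΔ_d(k) φ⟩`,
`W_K` the `(2K+1)²` longest-wavelength pair momenta) dominates its `k = 0` term, every term being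
`‖Δ_d(k)φ‖²/L⁴ ≥ 0`, and the `k = 0` term is the `d`-wave LRO density `L⁻⁴ Re⟨φ, Δ_dᴴΔ_d φ⟩`
(`pairMode_zero`). Hence:

* `tgLowEnergyCondensation_of_lowEnergyRigidity : LowEnergyRigidity → TgLowEnergyCondensation`
  (window `K = 0`, `θ = a`, `Γ = κ`);
* `tgLowEnergyCondensation_of_tgThesis : TgThesis → TgLowEnergyCondensation` (through the landed
  `lowEnergyRigidity_iff_tgThesis`).

With the landed `lowEnergyRigidity_of_tgCruxes` (`Rigidity ∧ Condensation ⇒ LowEnergyRigidity`) and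
`lowEnergyRigidity_iff_tgThesis`, this maps the two routes onto each other by name:
`TgThesis ⇔ LowEnergyRigidity ⇒ TgLowEnergyCondensation`, and
`TgPairMomentumRigidity ∧ TgLowEnergyCondensation ⇒ TgThesis` — route TwistGap is route
DeformationLadder's crux split into a condensation half (implied by it) and a universal stiffness
half. Finite sums only.

Sources: H. Tasaki, *Physics and Mathematics of Quantum Many-Body Systems* (2020) §2.1;
T. Kennedy, E. H. Lieb, B. S. Shastry, PRL 61 (1988) 2582 (pair structure factor). No definition is
introduced.
-/

set_option linter.dupNamespace false

noncomputable section

namespace Summit.HubbardSuperconductivity.HubbardSuperconductivity.Theorems.TwistGap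

open Matrix Literature.MathematicalPhysics.QuantumLattice Literature.Probability.LatticeModels
open Summit.HubbardSuperconductivity.HubbardSuperconductivity.Theses.TwistGap
open Summit.HubbardSuperconductivity.HubbardSuperconductivity.Theses.DeformationLadder (LowEnergyRigidity)
open Summit.HubbardSuperconductivity.HubbardSuperconductivity.Theorems.DeformationLadder
  (lowEnergyRigidity_iff_tgThesis)
open scoped ComplexOrder

/-- Every pair-momentum weight is nonnegative: `Re⟨φ, Mᴴ M φ⟩ = ‖M φ‖² ≥ 0`. [folklore] -/
theorem re_expect_conjTranspose_mul_self_nonneg {L : ℕ} [NeZero L]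
    (M : Matrix (Finset (Orb (FermionTorus 2 L))) (Finset (Orb (FermionTorus 2 L))) ℂ)
    (φ : Fock (Orb (FermionTorus 2 L))) : 0 ≤ (expect (Mᴴ * M) φ).re := by
  rw [expect, ← star_mulVec_dotProduct_mulVec]
  exact (Complex.nonneg_iff.1 (dotProduct_star_self_nonneg _)).1

/-- **The window sum dominates the LRO density**: for every `K`,
`L⁻⁴ Re⟨φ, Δ_dᴴΔ_d φ⟩ ≤ Σ_{k ∈ W_K} L⁻⁴ Re⟨φ, Δ_d(k)ᴴΔ_d(k) φ⟩` (the `k = 0` term of a sum of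
nonnegative terms; `Δ_d(0) = Δ_d` by `pairMode_zero`). [folklore] -/
theorem lro_le_windowSum (L : ℕ) [NeZero L] (K : ℕ) (φ : Fock (Orb (FermionTorus 2 L))) :
    (expect ((pairField dWaveFormFactor L)ᴴ * pairField dWaveFormFactor L) φ).re / (L : ℝ) ^ 4 ≤
      ∑ k ∈ (Finset.univ.filter (fun k : TorusSite 2 L =>
          ∀ i : Fin 2, min (k i).val (L - (k i).val) ≤ K)),
        (expect ((∑ x : TorusSite 2 L, Complex.exp (-(2 * (Real.pi : ℂ) * Complex.I / (L : ℂ)) *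
            ((∑ i : Fin 2, (k i).val * (x i).val : ℕ) : ℂ)) • localPair dWaveFormFactor L x)ᴴ *
          (∑ x : TorusSite 2 L, Complex.exp (-(2 * (Real.pi : ℂ) * Complex.I / (L : ℂ)) *
            ((∑ i : Fin 2, (k i).val * (x i).val : ℕ) : ℂ)) • localPair dWaveFormFactor L x)) φ).re /
          (L : ℝ) ^ 4 := by
  rw [windowSum_eq_zero_add]
  simp only [pairMode_zero]
  have hL4 : (0 : ℝ) ≤ (L : ℝ) ^ 4 := by positivity
  have hnonneg : 0 ≤ ∑ k ∈ (Finset.univ.filter (fun k : TorusSite 2 L =>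
      k ≠ 0 ∧ ∀ i : Fin 2, min (k i).val (L - (k i).val) ≤ K)),
        (expect ((∑ x : TorusSite 2 L, Complex.exp (-(2 * (Real.pi : ℂ) * Complex.I / (L : ℂ)) *
            ((∑ i : Fin 2, (k i).val * (x i).val : ℕ) : ℂ)) • localPair dWaveFormFactor L x)ᴴ *
          (∑ x : TorusSite 2 L, Complex.exp (-(2 * (Real.pi : ℂ) * Complex.I / (L : ℂ)) *
            ((∑ i : Fin 2, (k i).val * (x i).val : ℕ) : ℂ)) • localPair dWaveFormFactor L x)) φ).re /
          (L : ℝ) ^ 4 :=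
    Finset.sum_nonneg fun k _ => div_nonneg (re_expect_conjTranspose_mul_self_nonneg _ φ) hL4
  linarith

/-- **Route DeformationLadder's crux gives TwistGap's condensation half**:
`LowEnergyRigidity → TgLowEnergyCondensation`, with window `K = 0`, `θ = a`, `Γ = κ` (the window sum
dominates its `k = 0` term, which is the LRO density). [folklore] -/
theorem tgLowEnergyCondensation_of_lowEnergyRigidity (h : LowEnergyRigidity) :
    TgLowEnergyCondensation := by
  obtain ⟨U, hU, δ, hδ, κ, hκ, a, ha, L₀, h⟩ := h
  refine ⟨U, hU, δ, hδ, 0, a, ha, κ, hκ, L₀, fun L _ hL hev φ hmem hφ1 hE => ?_⟩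
  have h1 := h L hL hev φ hmem hφ1 (by unfold expect at hE; exact hE)
  exact h1.trans (lro_le_windowSum L 0 φ)

/-- **`S⁺` gives the condensation half**: `TgThesis → TgLowEnergyCondensation` (through
`lowEnergyRigidity_iff_tgThesis`). So route TwistGap's thesis is equivalent to route
DeformationLadder's crux, which already implies `TgLowEnergyCondensation`; the extra content of the
two-crux decomposition is the universal stiffness statement `TgPairMomentumRigidity`. [folklore] -/
theorem tgLowEnergyCondensation_of_tgThesis (h : TgThesis) : TgLowEnergyCondensation :=
  tgLowEnergyCondensation_of_lowEnergyRigidity (lowEnergyRigidity_iff_tgThesis.mpr h)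

end Summit.HubbardSuperconductivity.HubbardSuperconductivity.Theorems.TwistGap
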